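import Literature.NumberTheory.Rogawski1990.ArchChartBoxFlipCoherence
import Literature.NumberTheory.Rogawski1990.ArchTransferSideChartSum
import Literature.NumberTheory.Rogawski1990.ArchChartBoxCoherence
import Literature.NumberTheory.Rogawski1990.ArchChartPartnerClasses
import Literature.NumberTheory.Rogawski1990.ArchHCOrbitalFamilyG
import Literature.NumberTheory.Rogawski1990.ArchTransfFamilyWeylDischarge
import Literature.NumberTheory.Rogawski1990.ArchCompatibleFamilies
import Literature.NumberTheory.Rogawski1990.ArchBouazizStableFamily
import Literature.NumberTheory.Rogawski1990.ArchHCSpaceG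
import Literature.NumberTheory.Rogawski1990.ArchBouazizSpace
import Literature.NumberTheory.Automorphic.ArchInnerFormChartExhaustion
import Literature.NumberTheory.Automorphic.QuadraticHeckeCharacterCM
import Literature.NumberTheory.Automorphic.GodementHeightFloor
import HarnessLib

/-!
# R0 (O-READ ASSEMBLY): chart readings agreeing on the regular sets give the archimedean transfer identity `IsArchDeltaTransfer` at every `G`-regular `γ_H`
# (Rogawski 1990 §4.3 (4.3.1), §14.3; Shelstad 1979 §4; Bouaziz 1994 Rem. 2)

Topic `NumberTheory/Rogawski1990`; namespace `Literature.NumberTheory.Rogawski1990`.  THEOREMS ONLY (no `def`, no instance, no notation, no axiom, no named fact, no `sorry`).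
Cell `pub/hodgecm-mathlib`, crux H413 (`stmt-HodgeConjecture-24833`), F0∕P3c line LH3 (closer stub `stub_N9`, DIRECT ROAD «Transf», skeleton v2.1
`F0_P3c_StubN9Direct` organ `ReadStatement` = `stub_N9read`); organ **R0** of LH3-plan (g3) BOARD #1 (ii) 2026-09-02T07:08:21Z ∕ RULINGS #2 07:16:03Z; seat LH7-p01 (g2).
The telescope of **`isArchDeltaTransfer_of_chart_read`** IS the organ's, binder for binder (frame `Matrix.diagonal α`, `hl hr`, hermitian + anisotropic frame, the six
`letI ∕ haveI borel` lines, `m′ m mH t′ t tH`, ★ `ArchCompatibleFamiliesG` → ★ `ArchCompatibleFamiliesH` → `∀ a′ fH`, ★ `ArchSmooth` → ★ `ArchSmooth₂` → (∀ `S`, `stOrbFamH = transfFam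
(orbFamG)` on `RegS S`) → ★ `IsArchDeltaTransfer` for `Δ″_∞` = ★ `archExplicitTransferFactor`), so that the organ is paid by ONE LINE.  No by-text hypothesis.  Count-neutral.

THE MATHEMATICS (§14.3 (4.3.1) read on the Cartan charts).  Both sides of the identity `Φ^st(γ_H, f_H) = ∑ᶠ_{c′} Δ″(γ_H, out c′) Φ(c′, a′)` are class functions of the
`G`-regular `γ_H`, and every such `γ_H` is conjugate to a chart point `endoTorus S c`, `c ∈ RegG S` (★ R4 `isArchDeltaTransfer_of_forall_chart` over ★ (EXH-H)).  AT A CHART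
POINT: the stable side is `Φ^st · M(c) · R_H(c) = stOrbFamH S c` (★ READ-H discharged, `ArchChartBoxFlipCoherence`: the flip classes exhaust the stable class, the frame's box
mass `M(c) > 0` is flip-invariant); the `Δ″`-side is `partnerWeight · Σ_{ρ ∈ partnerPerms S} Δ″(endoTorus S c, gprimeTorus S (ρ•c)) Φ(⟦gprimeTorus S (ρ•c)⟧)` (★ R2 over
★ (hP2) `forall_conjClasses_eq_mk_gprimeTorus_slotPerm` and ★ P3's fibre count), and each partner term reads `Φ(⟦γ′_ρ⟧) · M′(ρ•c) = chartOrbG S a′ (ρ•c)` (★ R1 junction) with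
`M′(ρ•c) = M(c)` (★ R3 BOX-COH).  Hence `transfFamReg (orbFamG a′) S c = R_H(c) · M(c) · ∑ᶠ`, and the chart hypothesis `stOrbFamH S c = transfFam S c = transfFamReg S c`
(`c ∈ RegG S`) gives the identity after cancelling `M(c) R_H(c) ≠ 0`.  GUARDS: for an INADMISSIBLE label `S` (some `w ∈ S` not a split-chart place of the frame) both sides
vanish — `transfFam … S = 0` (★ `transfFam_eq_zero_of_not_admissible`) kills the stable side through the same READ-H identity, and `endoTorus S c` has no norm partner at
all (a partner class is regular, hence a chart class by ★ (EXH-G′) `exists_conj_gprimeTorus_of_isRegularElt`, excluded by ★ `not_isArchNormPair_endoTorus_gprimeTorus_of_not_mem_splitChartPlaces`);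
`G`-singular `γ_H` are outside the binder of ★ `IsArchDeltaTransfer`.
* §1 frame readings: `complexConj_apply_eq_of_diagonal_frame` (hermitian diagonal frame ⇒ `ᾱ_i = α_i`), `ne_zero_of_diagonal_anisotropic`;
* §2 `not_isArchNormPair_endoTorus_of_not_admissible` (the inadmissible guard, every `γ′`), `finsum_delta_mul_eq_zero_of_not_admissible`;
* §3 in a compatible frame (binders as in ★ R1∕R3∕READ-H): `transfFamReg_orbFamG_eq_finsum_mul` (admissible chart), **`stableOrbitalIntegralRel_endoTorus_eq_finsum_of_read`**
  (the identity at a chart point from the chart hypothesis, both guards);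
* §4 **`isArchDeltaTransfer_of_chart_read`** (= organ `ReadStatement`).
HONEST LABEL: HC_CM is proved only modulo the 7 printed citations (2 remaining: hLiu418 = `stmt-HodgeConjecture-24832`, h413 = `stmt-HodgeConjecture-24833`) until rung 0 closes;
this file pays the in-house organ `stub_N9read` of the LH3 direct road and no printed citation (+0∕+0).

## References
* [Rogawski1990] J. D. Rogawski, *Automorphic Representations of Unitary Groups in Three Variables*, Ann. of Math. Stud. 123 (1990), §4.3 (4.3.1) p. 43 (the transfer identity with
  compatible measures), §14.3 pp. 233–234 (the archimedean requirement), §4.1 (4.1.1) p. 39, §1.7 p. 6.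
* [Shelstad1979] D. Shelstad, *Characters and inner forms of a quasi-split group over ℝ*, Compositio Math. 39 (1979), §4 pp. 20–23 (`R_T`, `Ψ^T_f`, Lemma 4.2).
* [Bouaziz1994IntegralesOrbitales] A. Bouaziz, *Intégrales orbitales sur les groupes de Lie réductifs*, Ann. Sci. ÉNS 27 (1994), Rem. 2 p. 594 («Transf»).
-/

set_option autoImplicit false

noncomputable section

open MeasureTheory MeasureTheory.Measure NumberField NumberField.InfinitePlace Matrix Complex Topology
open Literature.MeasureTheory.Group
open scoped MatrixGroups Matrix Classical NNReal ENNReal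

namespace Literature.NumberTheory.Rogawski1990

open Literature.NumberTheory.Automorphic Literature.NumberTheory.Automorphic.UnitaryGroup Literature.NumberTheory.Automorphic.ArchCartan
open Literature.NumberTheory.GaloisRepresentations

/-! ## §1 Readings of the diagonal frame hypotheses -/

section Frame

variable {L : Type} [Field L] [NumberField L] [IsCMField L] {α : Fin 3 → L}

/-- A hermitian DIAGONAL frame (`(c(diag α))ᵀ = diag α`) has `c(α_i) = α_i`. [cite: Rogawski1990, §1.9 p. 8] -/
theorem complexConj_apply_eq_of_diagonal_frame (hherm : ((Matrix.diagonal α).map (cmConjRingHom L)).transpose = Matrix.diagonal α) (i : Fin 3) :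
    (IsCMField.complexConj L (α i) : L) = α i := by
  have h := congrFun (congrFun hherm i) i
  rw [Matrix.transpose_apply, Matrix.map_apply, Matrix.diagonal_apply_eq, cmConjRingHom_apply] at h
  exact h

/-- An anisotropic diagonal frame has nonzero entries. [cite: Rogawski1990, §1.9 p. 8] -/
theorem ne_zero_of_diagonal_anisotropic (hanis : ∀ x : Fin 3 → L, Literature.AlgebraicGeometry.ShimuraVarieties.hermForm (cmConjRingHom L) (Matrix.diagonal α) x x = 0 → x = 0) (i : Fin 3) : α i ≠ 0 := by
  intro h
  apply Godement.det_ne_zero_of_anisotropic L (Matrix.diagonal α) hanis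
  rw [Matrix.det_diagonal]
  exact Finset.prod_eq_zero (Finset.mem_univ i) h

end Frame

/-! ## §2 The inadmissible guard: no norm partner at all -/

section Guard

variable (L : Type) [Field L] [NumberField L] [IsCMField L] (α : Fin 3 → L)

/-- **NO NORM PARTNER FOR AN INADMISSIBLE CHART POINT, among ALL of `G′_∞`**: if some `w ∈ S` is not a split-chart place of the frame and `c ∈ RegG S`, then `endoTorus S c`
is in norm-pair position with NO `γ′ ∈ G′_∞` — a partner is regular (the norm pair transports regularity), hence conjugate to a chart point (★ (EXH-G′)), and chart points are
excluded place by place (★ `not_isArchNormPair_endoTorus_gprimeTorus_of_not_mem_splitChartPlaces`). [cite: Rogawski1990, §14.2 (14.2.1) p. 232; §4.3 p. 42] [cite: Shelstad1979, §4 p. 22] -/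
theorem not_isArchNormPair_endoTorus_of_not_admissible (hα : ∀ i, α i ≠ 0)
    (hreal : ∀ (w : {w : InfinitePlace L // IsComplex w}) (i : Fin 3), (w.1.embedding (α i)).im = 0)
    (S : Finset {w : InfinitePlace L // IsComplex w}) (hS : ¬ ∀ w, w ∈ S → w ∈ splitChartPlaces L α)
    (c : {w : InfinitePlace L // IsComplex w} → Fin 3 → ℝ) (hc : c ∈ ArchCartan.RegG S)
    (γ' : ↥(arch (↥(maximalRealSubfield L)) L (IsCMField.complexConj L) 3 (Matrix.diagonal α))) :
    ¬ IsArchNormPair L (Matrix.diagonal α) (endoTorus L S c) γ' := by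
  intro hnp
  simp only [not_forall] at hS
  obtain ⟨w, hw, hsp⟩ := hS
  have hregH : IsArchGRegular L (endoTorus L S c) := (isArchGRegular_endoTorus_iff_mem_regG L S c).2 hc
  have hreg : IsRegularElt (γ' : GL (Fin 3) (mixedEmbedding.mixedSpace L)) :=
    (isRegularElt_iff_of_corresponds ((isArchNormPair_iff L (Matrix.diagonal α) _ _).1 hnp)).1 hregH
  obtain ⟨S', c', g, _, _, hconj⟩ := exists_conj_gprimeTorus_of_isRegularElt L α hα hreal γ' hreg
  rw [hconj] at hnp
  exact not_isArchNormPair_endoTorus_gprimeTorus_of_not_mem_splitChartPlaces L α hw hsp (((ArchCartan.mem_regG_iff S c).1 hc).2 w hw) c'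
    ((isArchNormPair_conj_right L (Matrix.diagonal α) (endoTorus L S c) (gprimeTorus L α S' c') g).1 hnp)

/-- **The `Δ″`-side VANISHES at an inadmissible chart point** (every factor `Δ` of a transfer-factor datum is `0` off the norm pairs). [cite: Rogawski1990, §14.3 pp. 233–234] -/
theorem finsum_delta_mul_eq_zero_of_not_admissible (hα : ∀ i, α i ≠ 0)
    (hreal : ∀ (w : {w : InfinitePlace L // IsComplex w}) (i : Fin 3), (w.1.embedding (α i)).im = 0)
    (S : Finset {w : InfinitePlace L // IsComplex w}) (hS : ¬ ∀ w, w ∈ S → w ∈ splitChartPlaces L α)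
    (c : {w : InfinitePlace L // IsComplex w} → Fin 3 → ℝ) (hc : c ∈ ArchCartan.RegG S) (T : ArchTransferFactor L (Matrix.diagonal α))
    (Φ : ConjClasses ↥(arch (↥(maximalRealSubfield L)) L (IsCMField.complexConj L) 3 (Matrix.diagonal α)) → ℂ) :
    ∑ᶠ c' : ConjClasses ↥(arch (↥(maximalRealSubfield L)) L (IsCMField.complexConj L) 3 (Matrix.diagonal α)), T.Δ (endoTorus L S c) (Quotient.out c') * Φ c' = 0 := by
  refine finsum_eq_zero_of_forall_eq_zero fun c' => ?_
  rw [T.eq_zero_of_not_rel _ _ (not_isArchNormPair_endoTorus_of_not_admissible L α hα hreal S hS c hc _), zero_mul]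

end Guard

/-! ## §3 The chart identity in a compatible frame -/

section ChartRead

variable (L : Type) [Field L] [NumberField L] [IsCMField L] (α : Fin 3 → L)
  [MeasurableSpace ↥(UnitaryGroup.arch (↥(maximalRealSubfield L)) L (IsCMField.complexConj L) 3 (Matrix.diagonal α))] [BorelSpace ↥(UnitaryGroup.arch (↥(maximalRealSubfield L)) L (IsCMField.complexConj L) 3 (Matrix.diagonal α))] [MeasurableSpace ↥(UnitaryGroup.arch (↥(maximalRealSubfield L)) L (IsCMField.complexConj L) 3 (Matrix.of fun i j : Fin 3 => if i.val + j.val + 1 = 3 then (1 : L) else 0))] [BorelSpace ↥(UnitaryGroup.arch (↥(maximalRealSubfield L)) L (IsCMField.complexConj L) 3 (Matrix.of fun i j : Fin 3 => if i.val + j.val + 1 = 3 then (1 : L) else 0))] [MeasurableSpace (UnitaryGroup.arch (↥(maximalRealSubfield L)) L (IsCMField.complexConj L) 2 (Matrix.of fun i j : Fin 2 => if i.val + j.val + 1 = 2 then (1 : L) else 0) × UnitaryGroup.arch (↥(maximalRealSubfield L)) L (IsCMField.complexConj L) 1 (Matrix.of fun i j : Fin 1 => if i.val + j.val + 1 = 1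 then (1 : L) else 0))] [BorelSpace (UnitaryGroup.arch (↥(maximalRealSubfield L)) L (IsCMField.complexConj L) 2 (Matrix.of fun i j : Fin 2 => if i.val + j.val + 1 = 2 then (1 : L) else 0) × UnitaryGroup.arch (↥(maximalRealSubfield L)) L (IsCMField.complexConj L) 1 (Matrix.of fun i j : Fin 1 => if i.val + j.val + 1 = 1 then (1 : L) else 0))]
  -- orbit-quotient σ-algebras (binders; `borel` in the organ's frame)
  [qGP : ∀ γ' : ↥(UnitaryGroup.arch (↥(maximalRealSubfield L)) L (IsCMField.complexConj L) 3 (Matrix.diagonal α)), MeasurableSpace (↥(UnitaryGroup.arch (↥(maximalRealSubfield L)) L (IsCMField.complexConj L) 3 (Matrix.diagonal α)) ⧸ Subgroup.centralizer ({γ'} : Set ↥(UnitaryGroup.arch (↥(maximalRealSubfield L)) L (IsCMField.complexConj L) 3 (Matrix.diagonal α))))]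
  [qbGP : ∀ γ' : ↥(UnitaryGroup.arch (↥(maximalRealSubfield L)) L (IsCMField.complexConj L) 3 (Matrix.diagonal α)), BorelSpace (↥(UnitaryGroup.arch (↥(maximalRealSubfield L)) L (IsCMField.complexConj L) 3 (Matrix.diagonal α)) ⧸ Subgroup.centralizer ({γ'} : Set ↥(UnitaryGroup.arch (↥(maximalRealSubfield L)) L (IsCMField.complexConj L) 3 (Matrix.diagonal α))))]
  [qHH : ∀ a : (UnitaryGroup.arch (↥(maximalRealSubfield L)) L (IsCMField.complexConj L) 2 (Matrix.of fun i j : Fin 2 => if i.val + j.val + 1 = 2 then (1 : L) else 0) × UnitaryGroup.arch (↥(maximalRealSubfield L)) L (IsCMField.complexConj L) 1 (Matrix.of fun i j : Fin 1 => if i.val + j.val + 1 = 1 then (1 : L) else 0)), MeasurableSpace ((UnitaryGroup.arch (↥(maximalRealSubfield L)) L (IsCMField.complexConj L) 2 (Matrix.of fun i j : Fin 2 => if i.val + j.val + 1 = 2 then (1 : L) else 0) × UnitaryGroup.arch (↥(maximalRealSubfield L)) L (IsCMField.complexConj L) 1 (Matrix.of fun i j : Fin 1 => if i.val + j.val + 1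 = 1 then (1 : L) else 0)) ⧸ Subgroup.centralizer ({a} : Set (UnitaryGroup.arch (↥(maximalRealSubfield L)) L (IsCMField.complexConj L) 2 (Matrix.of fun i j : Fin 2 => if i.val + j.val + 1 = 2 then (1 : L) else 0) × UnitaryGroup.arch (↥(maximalRealSubfield L)) L (IsCMField.complexConj L) 1 (Matrix.of fun i j : Fin 1 => if i.val + j.val + 1 = 1 then (1 : L) else 0))))]
  [qbHH : ∀ a : (UnitaryGroup.arch (↥(maximalRealSubfield L)) L (IsCMField.complexConj L) 2 (Matrix.of fun i j : Fin 2 => if i.val + j.val + 1 = 2 then (1 : L) else 0) × UnitaryGroup.arch (↥(maximalRealSubfield L)) L (IsCMField.complexConj L) 1 (Matrix.of fun i j : Fin 1 => if i.val + j.val + 1 = 1 then (1 : L) else 0)), BorelSpace ((UnitaryGroup.arch (↥(maximalRealSubfield L)) L (IsCMField.complexConj L) 2 (Matrix.of fun i j : Fin 2 => if i.val + j.val + 1 = 2 then (1 : L) else 0) × UnitaryGroup.arch (↥(maximalRealSubfield L)) L (IsCMField.complexConj L) 1 (Matrix.of fun i j : Fin 1 => if i.val + j.val + 1 = 1 then (1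 : L) else 0)) ⧸ Subgroup.centralizer ({a} : Set (UnitaryGroup.arch (↥(maximalRealSubfield L)) L (IsCMField.complexConj L) 2 (Matrix.of fun i j : Fin 2 => if i.val + j.val + 1 = 2 then (1 : L) else 0) × UnitaryGroup.arch (↥(maximalRealSubfield L)) L (IsCMField.complexConj L) 1 (Matrix.of fun i j : Fin 1 => if i.val + j.val + 1 = 1 then (1 : L) else 0))))]
  (ν' : Measure ↥(UnitaryGroup.arch (↥(maximalRealSubfield L)) L (IsCMField.complexConj L) 3 (Matrix.diagonal α))) [ν'.IsHaarMeasure] [ν'.IsMulRightInvariant]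
  (νH : Measure (UnitaryGroup.arch (↥(maximalRealSubfield L)) L (IsCMField.complexConj L) 2 (Matrix.of fun i j : Fin 2 => if i.val + j.val + 1 = 2 then (1 : L) else 0) × UnitaryGroup.arch (↥(maximalRealSubfield L)) L (IsCMField.complexConj L) 1 (Matrix.of fun i j : Fin 1 => if i.val + j.val + 1 = 1 then (1 : L) else 0))) [νH.IsHaarMeasure] [νH.IsMulRightInvariant]
  (m' : OrbitalMeasureFamily ↥(UnitaryGroup.arch (↥(maximalRealSubfield L)) L (IsCMField.complexConj L) 3 (Matrix.diagonal α))) (mH : OrbitalMeasureFamily (UnitaryGroup.arch (↥(maximalRealSubfield L)) L (IsCMField.complexConj L) 2 (Matrix.of fun i j : Fin 2 => if i.val + j.val + 1 = 2 then (1 : L) else 0) × UnitaryGroup.arch (↥(maximalRealSubfield L)) L (IsCMField.complexConj L) 1 (Matrix.of fun i j : Fin 1 => if i.val + j.val + 1 = 1 then (1 : L) else 0)))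
  (t' : ∀ γ' : ↥(UnitaryGroup.arch (↥(maximalRealSubfield L)) L (IsCMField.complexConj L) 3 (Matrix.diagonal α)), Measure (Subgroup.centralizer ({γ'} : Set ↥(UnitaryGroup.arch (↥(maximalRealSubfield L)) L (IsCMField.complexConj L) 3 (Matrix.diagonal α)))))
  (t : ∀ γ : ↥(UnitaryGroup.arch (↥(maximalRealSubfield L)) L (IsCMField.complexConj L) 3 (Matrix.of fun i j : Fin 3 => if i.val + j.val + 1 = 3 then (1 : L) else 0)), Measure (Subgroup.centralizer ({γ} : Set ↥(UnitaryGroup.arch (↥(maximalRealSubfield L)) L (IsCMField.complexConj L) 3 (Matrix.of fun i j : Fin 3 => if i.val + j.val + 1 = 3 then (1 : L) else 0)))))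
  (tH : ∀ γH : (UnitaryGroup.arch (↥(maximalRealSubfield L)) L (IsCMField.complexConj L) 2 (Matrix.of fun i j : Fin 2 => if i.val + j.val + 1 = 2 then (1 : L) else 0) × UnitaryGroup.arch (↥(maximalRealSubfield L)) L (IsCMField.complexConj L) 1 (Matrix.of fun i j : Fin 1 => if i.val + j.val + 1 = 1 then (1 : L) else 0)), Measure (Subgroup.centralizer ({γH} : Set (UnitaryGroup.arch (↥(maximalRealSubfield L)) L (IsCMField.complexConj L) 2 (Matrix.of fun i j : Fin 2 => if i.val + j.val + 1 = 2 then (1 : L) else 0) × UnitaryGroup.arch (↥(maximalRealSubfield L)) L (IsCMField.complexConj L) 1 (Matrix.of fun i j : Fin 1 => if i.val + j.val + 1 = 1 then (1 : L) else 0)))))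
  (hd' : (Matrix.diagonal α).det ≠ 0) (hd₃ : ((Matrix.of fun i j : Fin 3 => if i.val + j.val + 1 = 3 then (1 : L) else 0) : Matrix (Fin 3) (Fin 3) L).det ≠ 0)
  -- (W′)(C′)(C)(C′G) of ★ `ArchCompatibleFamiliesG`, (W_H)(C_H) of ★ `ArchCompatibleFamiliesH`
  (hW' : m'.IsQuotientOf (fun γ => IsRegularElt (γ.val : GL (Fin 3) (mixedEmbedding.mixedSpace L))) ν' t')
  (hC' : ∀ (γ₁ γ₂ : ↥(UnitaryGroup.arch (↥(maximalRealSubfield L)) L (IsCMField.complexConj L) 3 (Matrix.diagonal α))) (h₁ : IsRegularElt (γ₁.val : GL (Fin 3) (mixedEmbedding.mixedSpace L)))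
      (hc : Corresponds (UnitaryGroup.conjMixed (↥(maximalRealSubfield L)) L (IsCMField.complexConj L))
        (UnitaryGroup.archFormOf L 3 (Matrix.diagonal α)) (UnitaryGroup.archFormOf L 3 (Matrix.diagonal α)) γ₁ γ₂),
      Measure.map ⇑(UnitaryGroup.archStableCentralizerEquiv L hd' hd' hc h₁) (t' γ₁) = t' γ₂)
  (hC : ∀ (γ₁ γ₂ : ↥(UnitaryGroup.arch (↥(maximalRealSubfield L)) L (IsCMField.complexConj L) 3 (Matrix.of fun i j : Fin 3 => if i.val + j.val + 1 = 3 then (1 : L) else 0))) (h₁ : IsRegularElt (γ₁.val : GL (Fin 3) (mixedEmbedding.mixedSpace L)))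
      (hc : Corresponds (UnitaryGroup.conjMixed (↥(maximalRealSubfield L)) L (IsCMField.complexConj L))
        (UnitaryGroup.archFormOf L 3 (Matrix.of fun i j : Fin 3 => if i.val + j.val + 1 = 3 then (1 : L) else 0))
        (UnitaryGroup.archFormOf L 3 (Matrix.of fun i j : Fin 3 => if i.val + j.val + 1 = 3 then (1 : L) else 0)) γ₁ γ₂),
      Measure.map ⇑(UnitaryGroup.archStableCentralizerEquiv L hd₃ hd₃ hc h₁) (t γ₁) = t γ₂)
  (hC'G : ∀ (γ' : ↥(UnitaryGroup.arch (↥(maximalRealSubfield L)) L (IsCMField.complexConj L) 3 (Matrix.diagonal α))) (γ : ↥(UnitaryGroup.arch (↥(maximalRealSubfield L)) L (IsCMField.complexConj L) 3 (Matrix.of fun i j : Fin 3 => if i.val + j.val + 1 = 3 then (1 : L) else 0))) (h' : IsRegularElt (γ'.val : GL (Fin 3) (mixedEmbedding.mixedSpace L)))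
      (hc : Corresponds (UnitaryGroup.conjMixed (↥(maximalRealSubfield L)) L (IsCMField.complexConj L))
        (UnitaryGroup.archFormOf L 3 (Matrix.diagonal α)) (UnitaryGroup.archFormOf L 3 (Matrix.of fun i j : Fin 3 => if i.val + j.val + 1 = 3 then (1 : L) else 0)) γ' γ),
      Measure.map ⇑(UnitaryGroup.archStableCentralizerEquiv L hd' hd₃ hc h') (t' γ') = t γ)
  (hCH : ∀ γH : (UnitaryGroup.arch (↥(maximalRealSubfield L)) L (IsCMField.complexConj L) 2 (Matrix.of fun i j : Fin 2 => if i.val + j.val + 1 = 2 then (1 : L) else 0) × UnitaryGroup.arch (↥(maximalRealSubfield L)) L (IsCMField.complexConj L) 1 (Matrix.of fun i j : Fin 1 => if i.val + j.val + 1 = 1 then (1 : L) else 0)), IsArchGRegular L γH → Measure.map ⇑(endoEmbArchCentralizer L γH) (tH γH) = t (endoEmbArch L γH))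
  (hWH : mH.IsQuotientOf (IsArchGRegular L) νH tH)
  -- the factor `Δ″_∞`
  (μ : HeckeCharacter L)
  (hl : ∀ (a : (UnitaryGroup.arch (↥(maximalRealSubfield L)) L (IsCMField.complexConj L) 2 (Matrix.of fun i j : Fin 2 => if i.val + j.val + 1 = 2 then (1 : L) else 0) × UnitaryGroup.arch (↥(maximalRealSubfield L)) L (IsCMField.complexConj L) 1 (Matrix.of fun i j : Fin 1 => if i.val + j.val + 1 = 1 then (1 : L) else 0))) (b : ↥(UnitaryGroup.arch (↥(maximalRealSubfield L)) L (IsCMField.complexConj L) 3 (Matrix.diagonal α))) (x : (UnitaryGroup.arch (↥(maximalRealSubfield L)) L (IsCMField.complexConj L) 2 (Matrix.of fun i j : Fin 2 => if i.val + j.val + 1 = 2 then (1 : L) else 0) × UnitaryGroup.arch (↥(maximalRealSubfield L)) L (IsCMField.complexConj L) 1 (Matrix.of fun i j : Fin 1 => if i.val + j.val + 1 = 1 then (1 : L) else 0))), archExplicitDelta L (Matrix.diagonal α) (x * a * x⁻¹) μ b = archExplicitDelta L (Matrix.diagonal α) a μ b)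
  (hr : ∀ (a : (UnitaryGroup.arch (↥(maximalRealSubfield L)) L (IsCMField.complexConj L) 2 (Matrix.of fun i j : Fin 2 => if i.val + j.val + 1 = 2 then (1 : L) else 0) × UnitaryGroup.arch (↥(maximalRealSubfield L)) L (IsCMField.complexConj L) 1 (Matrix.of fun i j : Fin 1 => if i.val + j.val + 1 = 1 then (1 : L) else 0))) (b y : ↥(UnitaryGroup.arch (↥(maximalRealSubfield L)) L (IsCMField.complexConj L) 3 (Matrix.diagonal α))), archExplicitDelta L (Matrix.diagonal α) a μ (y * b * y⁻¹) = archExplicitDelta L (Matrix.diagonal α) a μ b)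

omit qHH qbHH in
include hW' hC' hC'G hCH in
/-- **`Transf_{Δ″}` OF THE ORDINARY ORBITAL FAMILY, READ IN THE FRAME** (admissible chart `S`, `c ∈ RegG S`):
`transfFamReg (orbFamG ν′ a′) S c = (∑ᶠ_{c′} Δ″(endoTorus S c, out c′) · Φ(c′, a′; m′)) · M(c) · R_H(c)` — ★ R2 (partner sum, with ★ (hP2) + ★ P3), ★ R1 (junction:
`Φ(⟦γ′_ρ⟧) · M′ = chartOrbG (ρ•c)`), ★ R3 (BOX-COH: `M′ = M(c)`), ★ `orbFamG_apply`. [cite: Rogawski1990, §4.3 (4.3.1) p. 43; §14.3 pp. 233–234] [cite: Shelstad1979, §4 pp. 22–23] -/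
theorem transfFamReg_orbFamG_eq_finsum_mul (hα : ∀ i, α i ≠ 0) (hhermα : ∀ i, (IsCMField.complexConj L (α i) : L) = α i)
    (hreal : ∀ (w : {w : InfinitePlace L // IsComplex w}) (i : Fin 3), (w.1.embedding (α i)).im = 0) (a' : ↥(UnitaryGroup.arch (↥(maximalRealSubfield L)) L (IsCMField.complexConj L) 3 (Matrix.diagonal α)) → ℂ)
    {S : Finset {w : InfinitePlace L // IsComplex w}} (hadm : ∀ w, w ∈ S → w ∈ splitChartPlaces L α) {c : {w : InfinitePlace L // IsComplex w} → Fin 3 → ℝ} (hc : c ∈ ArchCartan.RegG S) :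
    transfFamReg L α μ (orbFamG L α ν' a') S c = (∑ᶠ c' : ConjClasses ↥(UnitaryGroup.arch (↥(maximalRealSubfield L)) L (IsCMField.complexConj L) 3 (Matrix.diagonal α)), (archExplicitTransferFactor L (Matrix.diagonal α) μ hl hr).Δ (endoTorus L S c) (Quotient.out c') * classOrbitalIntegral m' a' c') * (((tH (endoTorus L S c)).map ⇑(MulEquiv.subgroupCongr (chartTorusH_eq_centralizer_of_mem_regS L S (ArchCartan.regG_subset_regS S hc))).symm (chartBoxImg L S)).toReal : ℂ) * archRH S c := by
  have hregH : IsArchGRegular L (endoTorus L S c) := (isArchGRegular_endoTorus_iff_mem_regG L S c).2 hc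
  -- (hP2), (hP3) and the Δ″-side as a partner sum
  have hP2 := forall_conjClasses_eq_mk_gprimeTorus_slotPerm L α S c hα hreal hadm hc
  have hP3 : ∀ ρ ∈ partnerPerms S,
      ((((partnerPerms S).filter fun ρ' => ConjClasses.mk (gprimeTorus L α S (slotPerm ρ' c)) = ConjClasses.mk (gprimeTorus L α S (slotPerm ρ c))).card : ℕ) : ℂ)⁻¹ =
        partnerWeight L α S := by
    intro ρ hρ
    rw [card_filter_partnerPerms_mk_gprimeTorus_slotPerm_eq L α hα hhermα ((ArchCartan.mem_regG_iff S c).1 hc).1 hρ]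
    exact inv_eq_of_mul_eq_one_right (natCast_prod_stabCard_mul_partnerWeight L α S)
  have hR2 := finsum_delta_mul_eq_partnerWeight_mul_sum L α (archExplicitTransferFactor L (Matrix.diagonal α) μ hl hr) (classOrbitalIntegral m' a') S c hP2 hP3
  -- each partner term: frame reading × box mass = chart reading, and the box mass is `M(c)` (BOX-COH)
  have hterm : ∀ ρ ∈ partnerPerms S,
      classOrbitalIntegral m' a' (ConjClasses.mk (gprimeTorus L α S (slotPerm ρ c))) * (((tH (endoTorus L S c)).map ⇑(MulEquiv.subgroupCongr (chartTorusH_eq_centralizer_of_mem_regS L S (ArchCartan.regG_subset_regS S hc))).symm (chartBoxImg L S)).toReal : ℂ) = chartOrbG L α ν' S a' (slotPerm ρ c) := by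
    intro ρ hρ
    have hρ1 : ∀ w, w ∈ S → ρ w = 1 := (mem_partnerPerms_iff S ρ).1 hρ
    have hcρ : slotPerm ρ c ∈ ArchCartan.RegG S := (slotPerm_mem_regG_iff hρ c).2 hc
    have hnp : IsArchNormPair L (Matrix.diagonal α) (endoTorus L S c) (gprimeTorus L α S (slotPerm ρ c)) :=
      isArchNormPair_endoTorus_gprimeTorus_perm L α S c hadm ρ hρ1
    have hR1 := classOrbitalIntegral_mul_measure_box_eq_chartOrbG L α ν' S m' t' hd' hW' hC' hα hadm hcρ a'
    have hR3 := map_subgroupCongr_symm_chartBoxImgG_eq L α t' t tH hd' hd₃ hC'G hCH hadm hρ1 hregH hnp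
      (chartTorusH_eq_centralizer_of_mem_regS L S (ArchCartan.regG_subset_regS S hc)) (chartTorusG_eq_centralizer L α S hα hadm hcρ)
    rw [hR3] at hR1
    exact hR1
  -- assemble
  rw [hR2]
  unfold transfFamReg
  rw [mul_comm _ (archRH S c), mul_assoc (archRH S c) (partnerWeight L α S)]
  congr 1
  rw [Finset.mul_sum, Finset.mul_sum, Finset.sum_mul]
  refine Finset.sum_congr rfl fun ρ hρ => ?_
  have hcρ : slotPerm ρ c ∈ ArchCartan.RegG S := (slotPerm_mem_regG_iff hρ c).2 hc
  rw [orbFamG_apply L α ν' a' hadm (slotPerm ρ c), mul_div_cancel_left₀ _ (archRG_ne_zero_of_mem_regG hcρ), ← hterm ρ hρ,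
    archExplicitTransferFactor_Δ]
  ring

include hW' hC' hC hC'G hCH hWH in
/-- **THE TRANSFER IDENTITY AT A CHART POINT, READ FROM THE CHART HYPOTHESIS**: in a compatible frame, if `stOrbFamH S c = transfFam (orbFamG a′) S c` at a `G`-regular
chart point (`c ∈ RegG S`), then `Φ^st(endoTorus S c, f_H) = ∑ᶠ_{c′} Δ″(endoTorus S c, out c′) Φ(c′, a′)` — admissible `S`: ★ READ-H (flip box coherence) + §3 and cancel
`M(c) R_H(c) ≠ 0`; inadmissible `S`: both sides vanish (§2, ★ `transfFam_eq_zero_of_not_admissible`). [cite: Rogawski1990, §4.3 (4.3.1) p. 43; §14.3 pp. 233–234] -/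
theorem stableOrbitalIntegralRel_endoTorus_eq_finsum_of_read (hα : ∀ i, α i ≠ 0) (hhermα : ∀ i, (IsCMField.complexConj L (α i) : L) = α i)
    (hreal : ∀ (w : {w : InfinitePlace L // IsComplex w}) (i : Fin 3), (w.1.embedding (α i)).im = 0) (a' : ↥(UnitaryGroup.arch (↥(maximalRealSubfield L)) L (IsCMField.complexConj L) 3 (Matrix.diagonal α)) → ℂ) (fH : (UnitaryGroup.arch (↥(maximalRealSubfield L)) L (IsCMField.complexConj L) 2 (Matrix.of fun i j : Fin 2 => if i.val + j.val + 1 = 2 then (1 : L) else 0) × UnitaryGroup.arch (↥(maximalRealSubfield L)) L (IsCMField.complexConj L) 1 (Matrix.of fun i j : Fin 1 => if i.val + j.val + 1 = 1 then (1 : L) else 0)) → ℂ)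
    (S : Finset {w : InfinitePlace L // IsComplex w}) (c : {w : InfinitePlace L // IsComplex w} → Fin 3 → ℝ) (hc : c ∈ ArchCartan.RegG S)
    (hreadc : stOrbFamH L νH fH S c = transfFam L α μ (orbFamG L α ν' a') S c) :
    stableOrbitalIntegralRel (IsArchStablyConjH L) mH fH (endoTorus L S c) = ∑ᶠ c' : ConjClasses ↥(UnitaryGroup.arch (↥(maximalRealSubfield L)) L (IsCMField.complexConj L) 3 (Matrix.diagonal α)), (archExplicitTransferFactor L (Matrix.diagonal α) μ hl hr).Δ (endoTorus L S c) (Quotient.out c') * classOrbitalIntegral m' a' c' := by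
  have hcS : c ∈ ArchCartan.RegS S := ArchCartan.regG_subset_regS S hc
  have hRH : archRH S c ≠ 0 := archRH_ne_zero_of_mem_regS hcS
  have hMpos := toReal_map_tH_endoTorus_chartBoxImg_pos L t tH hd₃ hC hCH νH mH hWH S hc
  have hM : (((tH (endoTorus L S c)).map ⇑(MulEquiv.subgroupCongr (chartTorusH_eq_centralizer_of_mem_regS L S (ArchCartan.regG_subset_regS S hc))).symm (chartBoxImg L S)).toReal : ℂ) ≠ 0 := Complex.ofReal_ne_zero.2 hMpos.ne'
  have hH4 := stableOrbitalIntegralRel_endoTorus_mul_boxMass_eq_stOrbFamH L t tH hd₃ hC hCH νH mH hWH S hc fH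
  by_cases hadm : ∀ w, w ∈ S → w ∈ splitChartPlaces L α
  · -- ADMISSIBLE chart
    have hreg := transfFamReg_orbFamG_eq_finsum_mul L α ν' m' t' t tH hd' hd₃ hW' hC' hC'G hCH μ hl hr hα hhermα hreal a' hadm hc
    rw [transfFam_of_mem_regG L α μ (orbFamG L α ν' a') S hc, hreg] at hreadc
    rw [hreadc] at hH4
    exact mul_right_cancel₀ hM (mul_right_cancel₀ hRH hH4)
  · -- INADMISSIBLE chart: both sides vanish
    have h00 := congrFun (transfFam_eq_zero_of_not_admissible L α μ (orbFamG L α ν' a') hadm) c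
    have h0 : _ = (0 : ℂ) := (hH4.trans hreadc).trans h00
    have h1 := (mul_eq_zero.1 h0).resolve_right hRH
    have h2 := (mul_eq_zero.1 h1).resolve_right hM
    have hz := finsum_delta_mul_eq_zero_of_not_admissible L α hα hreal S hadm c hc
      (archExplicitTransferFactor L (Matrix.diagonal α) μ hl hr) (classOrbitalIntegral m' a')
    exact h2.trans hz.symm

end ChartRead

/-! ## §4 The assembly: organ `ReadStatement` of the LH3 direct road -/

/-- **R0 (O-READ ASSEMBLY) — CHART READINGS AGREEING ON THE REGULAR SETS GIVE THE ARCHIMEDEAN TRANSFER IDENTITY.**  In the diagonal frame `H′ = diag α` (hermitian,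
anisotropic), for Haar measures `ν′, ν, νH`, a unitary `μ` restricting to `ω_{L/L⁺}`, conjugation-invariance witnesses `hl, hr` of `Δ″_∞`, measure families in print's
convention (★ `ArchCompatibleFamiliesG`, ★ `ArchCompatibleFamiliesH`) and test functions `a′ ∈ C_c^∞(G′_∞)`, `f_H ∈ C_c^∞(H_∞)`: if on EVERY `H`-chart `S` the stable orbital
family of `f_H` agrees with «`Transf_{Δ″}`» of the ordinary orbital family of `a′` on the regular set `RegS S`, then `f_H` is a `Δ″_∞`-transfer of `a′`
(★ `IsArchDeltaTransfer`: §14.3's identity at every `G`-regular `γ_H`).  The telescope is that of the skeleton organ `ReadStatement` (v2.1 :116–143), verbatim.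
[cite: Rogawski1990, §4.3 (4.3.1) p. 43; §14.3 pp. 233–234] [cite: Shelstad1979, §4 pp. 20–23] [cite: Bouaziz1994IntegralesOrbitales, Rem. 2 p. 594] -/
theorem isArchDeltaTransfer_of_chart_read :
  ∀ (L : Type) [Field L] [NumberField L] [IsCMField L] (α : Fin 3 → L)
    [MeasurableSpace ↥(UnitaryGroup.arch (↥(maximalRealSubfield L)) L (IsCMField.complexConj L) 3 (Matrix.diagonal α))] [BorelSpace ↥(UnitaryGroup.arch (↥(maximalRealSubfield L)) L (IsCMField.complexConj L) 3 (Matrix.diagonal α))] [MeasurableSpace ↥(UnitaryGroup.arch (↥(maximalRealSubfield L)) L (IsCMField.complexConj L) 3 (Matrix.of fun i j : Fin 3 => if i.val + j.val + 1 = 3 then (1 : L) else 0))] [BorelSpace ↥(UnitaryGroup.arch (↥(maximalRealSubfield L)) L (IsCMField.complexConj L) 3 (Matrix.of fun i j : Fin 3 => if i.val + j.val + 1 = 3 then (1 : L) else 0))] [MeasurableSpace (UnitaryGroup.arch (↥(maximalRealSubfield L)) L (IsCMField.complexConj L) 2 (Matrix.of fun i j : Fin 2 => if i.val + j.val + 1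 = 2 then (1 : L) else 0) × UnitaryGroup.arch (↥(maximalRealSubfield L)) L (IsCMField.complexConj L) 1 (Matrix.of fun i j : Fin 1 => if i.val + j.val + 1 = 1 then (1 : L) else 0))] [BorelSpace (UnitaryGroup.arch (↥(maximalRealSubfield L)) L (IsCMField.complexConj L) 2 (Matrix.of fun i j : Fin 2 => if i.val + j.val + 1 = 2 then (1 : L) else 0) × UnitaryGroup.arch (↥(maximalRealSubfield L)) L (IsCMField.complexConj L) 1 (Matrix.of fun i j : Fin 1 => if i.val + j.val + 1 = 1 then (1 : L) else 0))]
    (ν' : Measure ↥(UnitaryGroup.arch (↥(maximalRealSubfield L)) L (IsCMField.complexConj L) 3 (Matrix.diagonal α))) (ν : Measure ↥(UnitaryGroup.arch (↥(maximalRealSubfield L)) L (IsCMField.complexConj L) 3 (Matrix.of fun i j : Fin 3 => if i.val + j.val + 1 = 3 then (1 : L) else 0))) (νH : Measure (UnitaryGroup.arch (↥(maximalRealSubfield L)) L (IsCMField.complexConj L) 2 (Matrix.of fun i j : Fin 2 => if i.val + j.val + 1 = 2 then (1 : L) else 0) × UnitaryGroup.arch (↥(maximalRealSubfield L)) L (IsCMField.complexConj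 L) 1 (Matrix.of fun i j : Fin 1 => if i.val + j.val + 1 = 1 then (1 : L) else 0)))
    [ν'.IsHaarMeasure] [ν'.IsMulRightInvariant] [ν.IsHaarMeasure] [ν.IsMulRightInvariant] [νH.IsHaarMeasure] [νH.IsMulRightInvariant]
    (μ : HeckeCharacter L) (_hμu : μ.IsUnitary)
    (_hμω : ∀ x : Literature.NumberTheory.GaloisRepresentations.ideleGroup ↥(maximalRealSubfield L), μ (AdeleRing.ideleBaseChange (↥(maximalRealSubfield L)) L x) = quadraticHeckeCharCM L x)
    (hl : ∀ (a : (UnitaryGroup.arch (↥(maximalRealSubfield L)) L (IsCMField.complexConj L) 2 (Matrix.of fun i j : Fin 2 => if i.val + j.val + 1 = 2 then (1 : L) else 0) × UnitaryGroup.arch (↥(maximalRealSubfield L)) L (IsCMField.complexConj L) 1 (Matrix.of fun i j : Fin 1 => if i.val + j.val + 1 = 1 then (1 : L) else 0))) (b : ↥(UnitaryGroup.arch (↥(maximalRealSubfield L)) L (IsCMField.complexConj L) 3 (Matrix.diagonal α))) (x : (UnitaryGroup.arch (↥(maximalRealSubfield L)) L (IsCMField.complexConj L) 2 (Matrix.of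 fun i j : Fin 2 => if i.val + j.val + 1 = 2 then (1 : L) else 0) × UnitaryGroup.arch (↥(maximalRealSubfield L)) L (IsCMField.complexConj L) 1 (Matrix.of fun i j : Fin 1 => if i.val + j.val + 1 = 1 then (1 : L) else 0))),
      archExplicitDelta L (Matrix.diagonal α) (x * a * x⁻¹) μ b = archExplicitDelta L (Matrix.diagonal α) a μ b)
    (hr : ∀ (a : (UnitaryGroup.arch (↥(maximalRealSubfield L)) L (IsCMField.complexConj L) 2 (Matrix.of fun i j : Fin 2 => if i.val + j.val + 1 = 2 then (1 : L) else 0) × UnitaryGroup.arch (↥(maximalRealSubfield L)) L (IsCMField.complexConj L) 1 (Matrix.of fun i j : Fin 1 => if i.val + j.val + 1 = 1 then (1 : L) else 0))) (b y : ↥(UnitaryGroup.arch (↥(maximalRealSubfield L)) L (IsCMField.complexConj L) 3 (Matrix.diagonal α))),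
      archExplicitDelta L (Matrix.diagonal α) a μ (y * b * y⁻¹) = archExplicitDelta L (Matrix.diagonal α) a μ b),
    ((Matrix.diagonal α).map (cmConjRingHom L)).transpose = Matrix.diagonal α →
      ∀ hanis : (∀ x : Fin 3 → L, Literature.AlgebraicGeometry.ShimuraVarieties.hermForm (cmConjRingHom L) (Matrix.diagonal α) x x = 0 → x = 0),
        letI : ∀ γ : ↥(UnitaryGroup.arch (↥(maximalRealSubfield L)) L (IsCMField.complexConj L) 3 (Matrix.diagonal α)), MeasurableSpace (↥(UnitaryGroup.arch (↥(maximalRealSubfield L)) L (IsCMField.complexConj L) 3 (Matrix.diagonal α)) ⧸ Subgroup.centralizer ({γ} : Set ↥(UnitaryGroup.arch (↥(maximalRealSubfield L)) L (IsCMField.complexConj L) 3 (Matrix.diagonal α)))) := fun _ => borel _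
        haveI : ∀ γ : ↥(UnitaryGroup.arch (↥(maximalRealSubfield L)) L (IsCMField.complexConj L) 3 (Matrix.diagonal α)), BorelSpace (↥(UnitaryGroup.arch (↥(maximalRealSubfield L)) L (IsCMField.complexConj L) 3 (Matrix.diagonal α)) ⧸ Subgroup.centralizer ({γ} : Set ↥(UnitaryGroup.arch (↥(maximalRealSubfield L)) L (IsCMField.complexConj L) 3 (Matrix.diagonal α)))) := fun _ => ⟨rfl⟩
        letI : ∀ γ : ↥(UnitaryGroup.arch (↥(maximalRealSubfield L)) L (IsCMField.complexConj L) 3 (Matrix.of fun i j : Fin 3 => if i.val + j.val + 1 = 3 then (1 : L) else 0)), MeasurableSpace (↥(UnitaryGroup.arch (↥(maximalRealSubfield L)) L (IsCMField.complexConj L) 3 (Matrix.of fun i j : Fin 3 => if i.val + j.val + 1 = 3 then (1 : L) else 0)) ⧸ Subgroup.centralizer ({γ} : Set ↥(UnitaryGroup.arch (↥(maximalRealSubfield L)) L (IsCMField.complexConj L) 3 (Matrix.of fun i j : Fin 3 => if i.val + j.val + 1 = 3 then (1 : L) else 0)))) := fun _ => borel _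
        haveI : ∀ γ : ↥(UnitaryGroup.arch (↥(maximalRealSubfield L)) L (IsCMField.complexConj L) 3 (Matrix.of fun i j : Fin 3 => if i.val + j.val + 1 = 3 then (1 : L) else 0)), BorelSpace (↥(UnitaryGroup.arch (↥(maximalRealSubfield L)) L (IsCMField.complexConj L) 3 (Matrix.of fun i j : Fin 3 => if i.val + j.val + 1 = 3 then (1 : L) else 0)) ⧸ Subgroup.centralizer ({γ} : Set ↥(UnitaryGroup.arch (↥(maximalRealSubfield L)) L (IsCMField.complexConj L) 3 (Matrix.of fun i j : Fin 3 => if i.val + j.val + 1 = 3 then (1 : L) else 0)))) := fun _ => ⟨rfl⟩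
        letI : ∀ a : (UnitaryGroup.arch (↥(maximalRealSubfield L)) L (IsCMField.complexConj L) 2 (Matrix.of fun i j : Fin 2 => if i.val + j.val + 1 = 2 then (1 : L) else 0) × UnitaryGroup.arch (↥(maximalRealSubfield L)) L (IsCMField.complexConj L) 1 (Matrix.of fun i j : Fin 1 => if i.val + j.val + 1 = 1 then (1 : L) else 0)), MeasurableSpace ((UnitaryGroup.arch (↥(maximalRealSubfield L)) L (IsCMField.complexConj L) 2 (Matrix.of fun i j : Fin 2 => if i.val + j.val + 1 = 2 then (1 : L) else 0) × UnitaryGroup.arch (↥(maximalRealSubfield L)) L (IsCMField.complexConj L) 1 (Matrix.of fun i j : Fin 1 => if i.val + j.val + 1 = 1 then (1 : L) else 0)) ⧸ Subgroup.centralizer ({a} : Set (UnitaryGroup.arch (↥(maximalRealSubfield L)) L (IsCMField.complexConj L) 2 (Matrix.of fun i j : Fin 2 => if i.val + j.val + 1 = 2 then (1 : L) else 0) × UnitaryGroup.arch (↥(maximalRealSubfield L)) L (IsCMField.complexConj L) 1 (Matrix.of fun i j : Fin 1 => if i.val + j.val + 1 = 1 then (1 : L) else 0)))) := fun _ => borel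 _
        haveI : ∀ a : (UnitaryGroup.arch (↥(maximalRealSubfield L)) L (IsCMField.complexConj L) 2 (Matrix.of fun i j : Fin 2 => if i.val + j.val + 1 = 2 then (1 : L) else 0) × UnitaryGroup.arch (↥(maximalRealSubfield L)) L (IsCMField.complexConj L) 1 (Matrix.of fun i j : Fin 1 => if i.val + j.val + 1 = 1 then (1 : L) else 0)), BorelSpace ((UnitaryGroup.arch (↥(maximalRealSubfield L)) L (IsCMField.complexConj L) 2 (Matrix.of fun i j : Fin 2 => if i.val + j.val + 1 = 2 then (1 : L) else 0) × UnitaryGroup.arch (↥(maximalRealSubfield L)) L (IsCMField.complexConj L) 1 (Matrix.of fun i j : Fin 1 => if i.val + j.val + 1 = 1 then (1 : L) else 0)) ⧸ Subgroup.centralizer ({a} : Set (UnitaryGroup.arch (↥(maximalRealSubfield L)) L (IsCMField.complexConj L) 2 (Matrix.of fun i j : Fin 2 => if i.val + j.val + 1 = 2 then (1 : L) else 0) × UnitaryGroup.arch (↥(maximalRealSubfield L)) L (IsCMField.complexConj L) 1 (Matrix.of fun i j : Fin 1 => if i.val + j.val + 1 = 1 then (1 : L) else 0)))) := fun _ =>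 ⟨rfl⟩
        ∀ (m' : OrbitalMeasureFamily ↥(UnitaryGroup.arch (↥(maximalRealSubfield L)) L (IsCMField.complexConj L) 3 (Matrix.diagonal α))) (m : OrbitalMeasureFamily ↥(UnitaryGroup.arch (↥(maximalRealSubfield L)) L (IsCMField.complexConj L) 3 (Matrix.of fun i j : Fin 3 => if i.val + j.val + 1 = 3 then (1 : L) else 0))) (mH : OrbitalMeasureFamily (UnitaryGroup.arch (↥(maximalRealSubfield L)) L (IsCMField.complexConj L) 2 (Matrix.of fun i j : Fin 2 => if i.val + j.val + 1 = 2 then (1 : L) else 0) × UnitaryGroup.arch (↥(maximalRealSubfield L)) L (IsCMField.complexConj L) 1 (Matrix.of fun i j : Fin 1 => if i.val + j.val + 1 = 1 then (1 : L) else 0)))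
          (t' : ∀ γ' : ↥(UnitaryGroup.arch (↥(maximalRealSubfield L)) L (IsCMField.complexConj L) 3 (Matrix.diagonal α)), Measure (Subgroup.centralizer ({γ'} : Set ↥(UnitaryGroup.arch (↥(maximalRealSubfield L)) L (IsCMField.complexConj L) 3 (Matrix.diagonal α)))))
          (t : ∀ γ : ↥(UnitaryGroup.arch (↥(maximalRealSubfield L)) L (IsCMField.complexConj L) 3 (Matrix.of fun i j : Fin 3 => if i.val + j.val + 1 = 3 then (1 : L) else 0)), Measure (Subgroup.centralizer ({γ} : Set ↥(UnitaryGroup.arch (↥(maximalRealSubfield L)) L (IsCMField.complexConj L) 3 (Matrix.of fun i j : Fin 3 => if i.val + j.val + 1 = 3 then (1 : L) else 0)))))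
          (tH : ∀ γH : (UnitaryGroup.arch (↥(maximalRealSubfield L)) L (IsCMField.complexConj L) 2 (Matrix.of fun i j : Fin 2 => if i.val + j.val + 1 = 2 then (1 : L) else 0) × UnitaryGroup.arch (↥(maximalRealSubfield L)) L (IsCMField.complexConj L) 1 (Matrix.of fun i j : Fin 1 => if i.val + j.val + 1 = 1 then (1 : L) else 0)), Measure (Subgroup.centralizer ({γH} : Set (UnitaryGroup.arch (↥(maximalRealSubfield L)) L (IsCMField.complexConj L) 2 (Matrix.of fun i j : Fin 2 => if i.val + j.val + 1 = 2 then (1 : L) else 0) × UnitaryGroup.arch (↥(maximalRealSubfield L)) L (IsCMField.complexConj L) 1 (Matrix.of fun i j : Fin 1 => if i.val + j.val + 1 = 1 then (1 : L) else 0))))),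
          ArchCompatibleFamiliesG L (Matrix.diagonal α) ν' ν hanis m' m t' t → ArchCompatibleFamiliesH L νH mH tH t →
            ∀ (a' : ↥(UnitaryGroup.arch (↥(maximalRealSubfield L)) L (IsCMField.complexConj L) 3 (Matrix.diagonal α)) → ℂ) (fH : (UnitaryGroup.arch (↥(maximalRealSubfield L)) L (IsCMField.complexConj L) 2 (Matrix.of fun i j : Fin 2 => if i.val + j.val + 1 = 2 then (1 : L) else 0) × UnitaryGroup.arch (↥(maximalRealSubfield L)) L (IsCMField.complexConj L) 1 (Matrix.of fun i j : Fin 1 => if i.val + j.val + 1 = 1 then (1 : L) else 0)) → ℂ), ArchSmooth L 3 (Matrix.diagonal α) a' → ArchSmooth₂ L fH →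
              (∀ S : Finset {w : InfinitePlace L // IsComplex w}, Set.EqOn (stOrbFamH L νH fH S) (transfFam L α μ (orbFamG L α ν' a') S) (RegS S)) →
                IsArchDeltaTransfer L (Matrix.diagonal α) (archExplicitTransferFactor L (Matrix.diagonal α) μ hl hr) mH m' fH a' := by
  intro L _ _ _ α _ _ _ _ _ _ ν' ν νH _ _ _ _ _ _ μ _hμu _hμω hl hr hherm hanis
  letI : ∀ γ : ↥(UnitaryGroup.arch (↥(maximalRealSubfield L)) L (IsCMField.complexConj L) 3 (Matrix.diagonal α)), MeasurableSpace (↥(UnitaryGroup.arch (↥(maximalRealSubfield L)) L (IsCMField.complexConj L) 3 (Matrix.diagonal α)) ⧸ Subgroup.centralizer ({γ} : Set ↥(UnitaryGroup.arch (↥(maximalRealSubfield L)) L (IsCMField.complexConj L) 3 (Matrix.diagonal α)))) := fun _ => borel _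
  haveI : ∀ γ : ↥(UnitaryGroup.arch (↥(maximalRealSubfield L)) L (IsCMField.complexConj L) 3 (Matrix.diagonal α)), BorelSpace (↥(UnitaryGroup.arch (↥(maximalRealSubfield L)) L (IsCMField.complexConj L) 3 (Matrix.diagonal α)) ⧸ Subgroup.centralizer ({γ} : Set ↥(UnitaryGroup.arch (↥(maximalRealSubfield L)) L (IsCMField.complexConj L) 3 (Matrix.diagonal α)))) := fun _ => ⟨rfl⟩
  letI : ∀ γ : ↥(UnitaryGroup.arch (↥(maximalRealSubfield L)) L (IsCMField.complexConj L) 3 (Matrix.of fun i j : Fin 3 => if i.val + j.val + 1 = 3 then (1 : L) else 0)), MeasurableSpace (↥(UnitaryGroup.arch (↥(maximalRealSubfield L)) L (IsCMField.complexConj L) 3 (Matrix.of fun i j : Fin 3 => if i.val + j.val + 1 = 3 then (1 : L) else 0)) ⧸ Subgroup.centralizer ({γ} : Set ↥(UnitaryGroup.arch (↥(maximalRealSubfield L)) L (IsCMField.complexConj L) 3 (Matrix.of fun i j : Fin 3 => if i.val + j.val + 1 = 3 then (1 : L) else 0)))) := fun _ => borel _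
  haveI : ∀ γ : ↥(UnitaryGroup.arch (↥(maximalRealSubfield L)) L (IsCMField.complexConj L) 3 (Matrix.of fun i j : Fin 3 => if i.val + j.val + 1 = 3 then (1 : L) else 0)), BorelSpace (↥(UnitaryGroup.arch (↥(maximalRealSubfield L)) L (IsCMField.complexConj L) 3 (Matrix.of fun i j : Fin 3 => if i.val + j.val + 1 = 3 then (1 : L) else 0)) ⧸ Subgroup.centralizer ({γ} : Set ↥(UnitaryGroup.arch (↥(maximalRealSubfield L)) L (IsCMField.complexConj L) 3 (Matrix.of fun i j : Fin 3 => if i.val + j.val + 1 = 3 then (1 : L) else 0)))) := fun _ => ⟨rfl⟩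
  letI : ∀ a : (UnitaryGroup.arch (↥(maximalRealSubfield L)) L (IsCMField.complexConj L) 2 (Matrix.of fun i j : Fin 2 => if i.val + j.val + 1 = 2 then (1 : L) else 0) × UnitaryGroup.arch (↥(maximalRealSubfield L)) L (IsCMField.complexConj L) 1 (Matrix.of fun i j : Fin 1 => if i.val + j.val + 1 = 1 then (1 : L) else 0)), MeasurableSpace ((UnitaryGroup.arch (↥(maximalRealSubfield L)) L (IsCMField.complexConj L) 2 (Matrix.of fun i j : Fin 2 => if i.val + j.val + 1 = 2 then (1 : L) else 0) × UnitaryGroup.arch (↥(maximalRealSubfield L)) L (IsCMField.complexConj L) 1 (Matrix.of fun i j : Fin 1 => if i.val + j.val + 1 = 1 then (1 : L) else 0)) ⧸ Subgroup.centralizer ({a} : Set (UnitaryGroup.arch (↥(maximalRealSubfield L)) L (IsCMField.complexConj L) 2 (Matrix.of fun i j : Fin 2 => if i.val + j.val + 1 = 2 then (1 : L) else 0) × UnitaryGroup.arch (↥(maximalRealSubfield L)) L (IsCMField.complexConj L) 1 (Matrix.of fun i j : Fin 1 => if i.val + j.val + 1 = 1 then (1 : L) else 0)))) := fun _ => borel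 _
  haveI : ∀ a : (UnitaryGroup.arch (↥(maximalRealSubfield L)) L (IsCMField.complexConj L) 2 (Matrix.of fun i j : Fin 2 => if i.val + j.val + 1 = 2 then (1 : L) else 0) × UnitaryGroup.arch (↥(maximalRealSubfield L)) L (IsCMField.complexConj L) 1 (Matrix.of fun i j : Fin 1 => if i.val + j.val + 1 = 1 then (1 : L) else 0)), BorelSpace ((UnitaryGroup.arch (↥(maximalRealSubfield L)) L (IsCMField.complexConj L) 2 (Matrix.of fun i j : Fin 2 => if i.val + j.val + 1 = 2 then (1 : L) else 0) × UnitaryGroup.arch (↥(maximalRealSubfield L)) L (IsCMField.complexConj L) 1 (Matrix.of fun i j : Fin 1 => if i.val + j.val + 1 = 1 then (1 : L) else 0)) ⧸ Subgroup.centralizer ({a} : Set (UnitaryGroup.arch (↥(maximalRealSubfield L)) L (IsCMField.complexConj L) 2 (Matrix.of fun i j : Fin 2 => if i.val + j.val + 1 = 2 then (1 : L) else 0) × UnitaryGroup.arch (↥(maximalRealSubfield L)) L (IsCMField.complexConj L) 1 (Matrix.of fun i j : Fin 1 => if i.val + j.val + 1 = 1 then (1 : L) else 0)))) := fun _ =>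 ⟨rfl⟩
  intro m' m mH t' t tH hG hH a' fH _ha' _hfH hread
  -- readings of the frame
  have hhermα : ∀ i, (IsCMField.complexConj L (α i) : L) = α i := complexConj_apply_eq_of_diagonal_frame hherm
  have hα : ∀ i, α i ≠ 0 := ne_zero_of_diagonal_anisotropic hanis
  have hreal : ∀ (w : {w : InfinitePlace L // IsComplex w}) (i : Fin 3), (w.1.embedding (α i)).im = 0 := fun w i => im_embedding_diagonal_eq_zero L 3 α hhermα w i
  obtain ⟨hW', -, hC', hC, hC'G⟩ := hG
  obtain ⟨hWH, hCH⟩ := hH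
  -- reduce to the chart points (both sides are class functions; ★ (EXH-H)), then read each chart point
  exact isArchDeltaTransfer_of_forall_chart L (archExplicitTransferFactor L (Matrix.diagonal α) μ hl hr) (fun a b x => hl a b x) mH m' fH a'
    fun S c hc => stableOrbitalIntegralRel_endoTorus_eq_finsum_of_read L α ν' νH m' mH t' t tH
      (Godement.det_ne_zero_of_anisotropic L (Matrix.diagonal α) hanis) (UnitaryGroup.isUnit_antidiagOne_det L 3).ne_zero
      hW' hC' hC hC'G hCH hWH μ hl hr hα hhermα hreal a' fH S c hc (hread S (ArchCartan.regG_subset_regS S hc))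

end Literature.NumberTheory.Rogawski1990

end
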